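import Mathlib
import Summits.NavierStokesRegularity.FluidComputer.TransportGalerkinFourierTransfer
import Literature.Analysis.FunctionSpaces.TorusLerayHelmholtzSpaceTime
import Literature.Analysis.FunctionSpaces.TorusSobolevNormHolderProofs
import HarnessLib

/-!
# The coefficient curve of a space–time smooth field is `C¹` INTO THE PHASE SPACE `E` (instab g20, cell `ns-blowup`, 2026-08-27)

HONEST FRAMING (human ruling D-0035): nothing here is a claim about Navier–Stokes blow-up.
WHAT THIS IS NOT: not NS evidence — Fourier bookkeeping for the PDE → lattice transfer of the R-β
chain; no flow, certificate, number or census word moves.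

PURPOSE. `TransportGalerkinFourierTransfer.hasDerivAt_mFourierCoeff_of_perturbationEq` (g20) is
MODEWISE: each coefficient of a classical solution of the perturbed system obeys the lattice ODE. The
chain's theorems (`TransportGalerkinUniqueLimit.tendstoUniformlyOn_of_smooth_solution`, …) want ONE
derivative in the `H²`-scaled phase space `E = ℓ²`. This file supplies it for any field
`ψ : ℝ → 𝕋³ → ℝ³` smooth on `ℝ × 𝕋³`:

* `exists_uniform_coeff_bound` — on every compact time interval, `‖𝓕(ψ s)(k)‖ ≤ K (1+|k|²)^{−m}`
  uniformly in `s` (any `m`; `Torus.isSmoothSpaceTimeOn_iterate`, `norm_mFourierCoeff_le_of_iterate_bound`);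
* `norm_coeff_taylor_le` — per mode, `‖𝓕(ψ(t+h))(k) − 𝓕(ψ t)(k) − h • 𝓕(∂ₜψ t)(k)‖ ≤ B h²` whenever
  `‖𝓕(∂ₜ∂ₜψ s)(k)‖ ≤ B` between `t` and `t + h` (mean value inequality twice);
* **`hasDerivAt_coeffCurve`** — `s ↦ Λ² 𝓕(ψ s)` (as an element of `E` via `ofCoeff`) is differentiable
  at every `t` IN `E`, with derivative `Λ² 𝓕(∂ₜψ t)`: the remainder has `E`-norm `≤ K √S h²`
  (`S = ∑⟨k⟩⁻⁴ < ∞` on `ℤ³`).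

With the modewise transfer this is the last bookkeeping step before the KEEP/KILL words of the chain
read classical solutions of the perturbed Navier–Stokes system on `𝕋³` (composition left to the
successor: identify the `E`-derivative with `nsField` by `coe` lemmas and apply the uniqueness theorems).
`d = 3`; Mathlib + the tree files cited; no new definitions.
-/

noncomputable section

namespace Summit.NavierStokesRegularity.FluidComputer.TransportGalerkinFourierCurve

open Set Filter Topology Finset MeasureTheory UnitAddTorus
open Literature.Analysis.FunctionSpaces Literature.Analysis.FunctionSpaces.Lattice
open Literature.Analysis.FunctionSpaces.Torus Literature.Analysis.FunctionSpaces.EuclideanSpace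
open Literature.Analysis.ODE
open Literature.Analysis.FluidPDE Literature.Analysis.FluidPDE.ScalarFourier
open Summit.NavierStokesRegularity.FluidComputer.GalerkinLatticePhaseSpace
open Summit.NavierStokesRegularity.FluidComputer.TransportGalerkin
open Summit.NavierStokesRegularity.FluidComputer.TransportGalerkinRapid
open Summit.NavierStokesRegularity.FluidComputer.TransportGalerkinEigen
open Summit.NavierStokesRegularity.FluidComputer.TransportGalerkinEigenFourier
open scoped ENNReal NNReal ComplexConjugate InnerProductSpace

/-! ## §1 Uniform coefficient bounds on compact time intervals -/

/-- **Uniform polynomial decay of the coefficients on compact time intervals**: for `ψ` smooth on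
`ℝ × 𝕋³`, every `m` and `T₁ ≤ T₂`... (any `T₁, T₂`): `‖𝓕(ψ s)(k)‖ ≤ K (1+|k|²)^{−m}` for all
`s ∈ [T₁, T₂]`, `k`. -/
theorem exists_uniform_coeff_bound {ψ : ℝ → UnitAddTorus (Fin 3) → EuclideanSpace ℝ (Fin 3)}
    (hψ : IsSmoothSpaceTimeOn univ ψ) (m : ℕ) (T₁ T₂ : ℝ) :
    ∃ K : ℝ, 0 ≤ K ∧ ∀ s ∈ Icc T₁ T₂, ∀ k : Fin 3 → ℤ,
      ‖mFourierCoeff (complexify ∘ ψ s) k‖ ≤ K * ((1 + freqNormSq k) ^ m)⁻¹ := by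
  obtain ⟨C, hC⟩ := (isSmoothSpaceTimeOn_iterate hψ m).exists_norm_le_of_isCompact isCompact_Icc (subset_univ _)
  refine ⟨max C 0, le_max_right _ _, fun s hs k => ?_⟩
  refine norm_mFourierCoeff_le_of_iterate_bound (hψ.isSmooth_slice (mem_univ s)) (fun x => ?_) k
  rw [← iterate_spaceTime_slice]
  exact (hC s hs x).trans (le_max_left _ _)

/-! ## §2 The per-mode Taylor remainder -/

/-- **Per-mode Taylor remainder**: if `‖𝓕(∂ₜ∂ₜψ s)(k)‖ ≤ B` for `s` between `t` and `t + h`, then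
`‖𝓕(ψ(t+h))(k) − 𝓕(ψ t)(k) − h • 𝓕(∂ₜψ t)(k)‖ ≤ B h²` (mean value inequality, twice). -/
theorem norm_coeff_taylor_le {ψ : ℝ → UnitAddTorus (Fin 3) → EuclideanSpace ℝ (Fin 3)}
    (hψ : IsSmoothSpaceTimeOn univ ψ) (k : Fin 3 → ℤ) (t h : ℝ) {B : ℝ}
    (hB : ∀ s ∈ uIcc t (t + h), ‖mFourierCoeff (complexify ∘ Torus.timeDeriv (Torus.timeDeriv ψ) s) k‖ ≤ B) :
    ‖mFourierCoeff (complexify ∘ ψ (t + h)) k - mFourierCoeff (complexify ∘ ψ t) k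
        - h • mFourierCoeff (complexify ∘ Torus.timeDeriv ψ t) k‖ ≤ B * h ^ 2 := by
  set c₁ : ℝ → EuclideanSpace ℂ (Fin 3) := fun s => mFourierCoeff (complexify ∘ Torus.timeDeriv ψ s) k with hc₁
  have hd1 : ∀ s, HasDerivAt (fun σ => mFourierCoeff (complexify ∘ ψ σ) k) (c₁ s) s := fun s =>
    Torus.hasDerivAt_mFourierCoeff_slice hψ k s
  have hd2 : ∀ s, HasDerivAt c₁ (mFourierCoeff (complexify ∘ Torus.timeDeriv (Torus.timeDeriv ψ) s) k) s :=
    fun s => Torus.hasDerivAt_mFourierCoeff_slice hψ.timeDeriv k s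
  have hB0 : 0 ≤ B := (norm_nonneg _).trans (hB t left_mem_uIcc)
  -- first: `‖c₁ s − c₁ t‖ ≤ B |s − t| ≤ B |h|`
  have h1 : ∀ s ∈ uIcc t (t + h), ‖c₁ s - c₁ t‖ ≤ B * |h| := by
    intro s hs
    have h := (convex_uIcc t (t + h)).norm_image_sub_le_of_norm_hasDerivWithin_le
      (fun x _ => (hd2 x).hasDerivWithinAt) (fun x hx => hB x hx) left_mem_uIcc hs
    refine h.trans (mul_le_mul_of_nonneg_left ?_ hB0)
    rw [Real.norm_eq_abs]
    have := abs_sub_left_of_mem_uIcc hs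
    rwa [add_sub_cancel_left] at this
  -- second: `g σ = 𝓕(ψ σ)(k) − (σ − t) • c₁ t`
  have hg : ∀ σ, HasDerivAt (fun σ => mFourierCoeff (complexify ∘ ψ σ) k - (σ - t) • c₁ t)
      (c₁ σ - (1 : ℝ) • c₁ t) σ := fun σ =>
    (hd1 σ).sub (((hasDerivAt_id σ).sub_const t).smul_const (c₁ t))
  have h2 := (convex_uIcc t (t + h)).norm_image_sub_le_of_norm_hasDerivWithin_le
    (fun x _ => (hg x).hasDerivWithinAt) (fun x hx => by rw [one_smul]; exact h1 x hx) left_mem_uIcc right_mem_uIcc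
  have heq : mFourierCoeff (complexify ∘ ψ (t + h)) k - (t + h - t) • c₁ t -
      (mFourierCoeff (complexify ∘ ψ t) k - (t - t) • c₁ t) =
      mFourierCoeff (complexify ∘ ψ (t + h)) k - mFourierCoeff (complexify ∘ ψ t) k - h • c₁ t := by
    rw [add_sub_cancel_left, sub_self, zero_smul, sub_zero]
    abel
  rw [heq, add_sub_cancel_left, Real.norm_eq_abs] at h2
  calc ‖mFourierCoeff (complexify ∘ ψ (t + h)) k - mFourierCoeff (complexify ∘ ψ t) k - h • c₁ t‖
      ≤ B * |h| * |h| := h2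
    _ = B * h ^ 2 := by rw [mul_assoc, ← sq, sq_abs]

/-! ## §3 The coefficient curve is differentiable in `E` -/

/-- `∑_k ⟨k⟩⁻⁴ < ∞` on `ℤ³`, as finiteness of the `H⁻²` energy of the constant family `1`. -/
theorem eNormSq_neg_two_const_lt_top :
    eNormSq (-2) (fun _ : Fin 3 → ℤ => (1 : ℂ)) < ∞ := by
  refine eNormSq_lt_top_of_summable ?_
  have h := summable_sobolevWeight_neg_sq (d := Fin 3) (t := 2) (by norm_num)
  exact h.congr fun k => by rw [norm_one, one_pow, mul_one]

/-- **The coefficient curve is `C¹` into `E`** (`hasDerivAt_coeffCurve`): for `ψ` smooth on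
`ℝ × 𝕋³`, the map `s ↦ Λ² 𝓕(ψ s)` into `E = ℓ²(ℤ³; ℂ³)` (via `ofCoeff`) has, at every `t`, the
`E`-derivative `Λ² 𝓕(∂ₜψ t)`. -/
theorem hasDerivAt_coeffCurve {ψ : ℝ → UnitAddTorus (Fin 3) → EuclideanSpace ℝ (Fin 3)}
    (hψ : IsSmoothSpaceTimeOn univ ψ) (t : ℝ) :
    HasDerivAt (fun s => (ofCoeff (wmul 2 (mFourierCoeff (complexify ∘ ψ s))) :
        lp (fun _ : (Fin 3 → ℤ) => EuclideanSpace ℂ (Fin 3)) 2))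
      (ofCoeff (wmul 2 (mFourierCoeff (complexify ∘ Torus.timeDeriv ψ t)))) t := by
  -- rapid decay of all slices
  have hr : ∀ s, RapidDecay (mFourierCoeff (complexify ∘ ψ s)) := fun s =>
    (hψ.isSmooth_slice (mem_univ s)).complexify_comp.rapidDecay_mFourierCoeff
  have hr1 : RapidDecay (mFourierCoeff (complexify ∘ Torus.timeDeriv ψ t)) :=
    (hψ.timeDeriv.isSmooth_slice (mem_univ t)).complexify_comp.rapidDecay_mFourierCoeff
  -- uniform bound of the second time derivative on `[t − 1, t + 1]`, order `m = 2`
  obtain ⟨K, hK0, hK⟩ := exists_uniform_coeff_bound hψ.timeDeriv.timeDeriv 2 (t - 1) (t + 1)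
  set S : ℝ := (eNormSq (-2) (fun _ : Fin 3 → ℤ => (1 : ℂ))).toReal with hS
  have hS0 : 0 ≤ S := ENNReal.toReal_nonneg
  -- the remainder estimate `‖R h‖ ≤ K √S h²` for `|h| ≤ 1`
  have hrem : ∀ h : ℝ, |h| ≤ 1 →
      ‖(ofCoeff (wmul 2 (mFourierCoeff (complexify ∘ ψ (t + h)))) :
          lp (fun _ : (Fin 3 → ℤ) => EuclideanSpace ℂ (Fin 3)) 2) -
        ofCoeff (wmul 2 (mFourierCoeff (complexify ∘ ψ t))) -
        h • ofCoeff (wmul 2 (mFourierCoeff (complexify ∘ Torus.timeDeriv ψ t)))‖ ≤ K * Real.sqrt S * h ^ 2 := by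
    intro h hh
    set R : lp (fun _ : (Fin 3 → ℤ) => EuclideanSpace ℂ (Fin 3)) 2 :=
      ofCoeff (wmul 2 (mFourierCoeff (complexify ∘ ψ (t + h)))) - ofCoeff (wmul 2 (mFourierCoeff (complexify ∘ ψ t))) -
        h • ofCoeff (wmul 2 (mFourierCoeff (complexify ∘ Torus.timeDeriv ψ t))) with hRdef
    -- segment inside `[t − 1, t + 1]`
    have hseg : uIcc t (t + h) ⊆ Icc (t - 1) (t + 1) := by
      refine uIcc_subset_Icc ⟨by linarith, by linarith⟩ ⟨?_, ?_⟩
      · linarith [(abs_le.1 hh).1]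
      · linarith [(abs_le.1 hh).2]
    -- coefficients of `R`
    have hcoe : ∀ k, (R : (Fin 3 → ℤ) → EuclideanSpace ℂ (Fin 3)) k = (sobolevWeight 2 k : ℂ) •
        (mFourierCoeff (complexify ∘ ψ (t + h)) k - mFourierCoeff (complexify ∘ ψ t) k -
          h • mFourierCoeff (complexify ∘ Torus.timeDeriv ψ t) k) := by
      intro k
      rw [hRdef, lp.coeFn_sub, lp.coeFn_sub, Pi.sub_apply, Pi.sub_apply, coe_real_smul_apply,
        coe_ofCoeff_wmul (hr (t + h)) 2, coe_ofCoeff_wmul (hr t) 2, coe_ofCoeff_wmul hr1 2, wmul_apply, wmul_apply,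
        wmul_apply, smul_sub, smul_sub, ← Complex.coe_smul h, smul_comm (h : ℂ)]
    -- per-mode bound
    have hmode : ∀ k, ‖(R : (Fin 3 → ℤ) → EuclideanSpace ℂ (Fin 3)) k‖ ≤
        (K * h ^ 2) * sobolevWeight (-2) k * ‖(fun _ : Fin 3 → ℤ => (1 : ℂ)) k‖ := by
      intro k
      have hBk : ∀ s ∈ uIcc t (t + h), ‖mFourierCoeff (complexify ∘ Torus.timeDeriv (Torus.timeDeriv ψ) s) k‖ ≤
          K * ((1 + freqNormSq k) ^ 2)⁻¹ := fun s hs => hK s (hseg hs) k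
      have htay := norm_coeff_taylor_le hψ k t h hBk
      rw [hcoe k, norm_smul, Complex.norm_real, Real.norm_of_nonneg (sobolevWeight_pos 2 k).le, norm_one, mul_one]
      have hw2 : sobolevWeight 2 k = 1 + freqNormSq k := by
        have := sobolevWeight_sq (1 : ℝ) k
        rw [Real.rpow_one] at this
        rw [← this, sq, ← sobolevWeight_add]; norm_num
      have hwm2 : sobolevWeight (-2) k = (1 + freqNormSq k)⁻¹ := by
        rw [sobolevWeight_neg, hw2]
      have hpos : 0 < 1 + freqNormSq k := by linarith [freqNormSq_nonneg k]
      calc sobolevWeight 2 k * ‖mFourierCoeff (complexify ∘ ψ (t + h)) k - mFourierCoeff (complexify ∘ ψ t) k -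
              h • mFourierCoeff (complexify ∘ Torus.timeDeriv ψ t) k‖
          ≤ (1 + freqNormSq k) * (K * ((1 + freqNormSq k) ^ 2)⁻¹ * h ^ 2) := by
            rw [hw2]; exact mul_le_mul_of_nonneg_left htay hpos.le
        _ = K * h ^ 2 * (1 + freqNormSq k)⁻¹ := by field_simp
        _ = K * h ^ 2 * sobolevWeight (-2) k := by rw [hwm2]
    -- the `E`-norm
    have hle := eNormSq_le_of_norm_le (s := 0) (by positivity : 0 ≤ K * h ^ 2) hmode
    rw [zero_add] at hle
    have hfin : eNormSq (-2) (fun _ : Fin 3 → ℤ => (1 : ℂ)) ≠ ∞ := eNormSq_neg_two_const_lt_top.ne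
    have hsq : ‖R‖ ^ 2 ≤ (K * h ^ 2) ^ 2 * S := by
      rw [norm_sq_eq_toReal_eNormSq_zero, hS]
      have := ENNReal.toReal_mono (ENNReal.mul_ne_top ENNReal.ofReal_ne_top hfin) hle
      rwa [ENNReal.toReal_mul, ENNReal.toReal_ofReal (sq_nonneg _)] at this
    have hKS : 0 ≤ K * Real.sqrt S * h ^ 2 := by positivity
    have h' : ‖R‖ ^ 2 ≤ (K * Real.sqrt S * h ^ 2) ^ 2 := by
      calc ‖R‖ ^ 2 ≤ (K * h ^ 2) ^ 2 * S := hsq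
        _ = (K * Real.sqrt S * h ^ 2) ^ 2 := by
            rw [mul_pow, mul_pow, mul_pow, Real.sq_sqrt hS0]; ring
    exact (pow_le_pow_iff_left₀ (norm_nonneg _) hKS two_ne_zero).1 h'
  -- little-o
  rw [hasDerivAt_iff_isLittleO_nhds_zero, Asymptotics.isLittleO_iff]
  intro c hc
  have hden : 0 < K * Real.sqrt S + 1 := by positivity
  have hev : ∀ᶠ h : ℝ in 𝓝 0, |h| < min 1 (c / (K * Real.sqrt S + 1)) := by
    have hpos : 0 < min 1 (c / (K * Real.sqrt S + 1)) := lt_min one_pos (div_pos hc hden)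
    filter_upwards [Metric.ball_mem_nhds (0 : ℝ) hpos] with h hh
    simpa [Real.dist_eq] using hh
  filter_upwards [hev] with h hh
  have hh1 : |h| ≤ 1 := (hh.trans_le (min_le_left _ _)).le
  have hh2 : |h| ≤ c / (K * Real.sqrt S + 1) := (hh.trans_le (min_le_right _ _)).le
  refine (hrem h hh1).trans ?_
  rw [Real.norm_eq_abs]
  have habs : 0 ≤ |h| := abs_nonneg h
  have hKS0 : 0 ≤ K * Real.sqrt S := by positivity
  calc K * Real.sqrt S * h ^ 2 = (K * Real.sqrt S * |h|) * |h| := by rw [← sq_abs]; ring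
    _ ≤ ((K * Real.sqrt S + 1) * (c / (K * Real.sqrt S + 1))) * |h| := by
        refine mul_le_mul_of_nonneg_right ?_ habs
        exact mul_le_mul (by linarith) hh2 habs hden.le
    _ = c * |h| := by field_simp

end Summit.NavierStokesRegularity.FluidComputer.TransportGalerkinFourierCurve

end
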